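import Summits.NavierStokesRegularity.NavierStokesRegularity.Theorems.FilamentSkeletonRssCoreGluingClassicalOfProfile
import Summits.NavierStokesRegularity.NavierStokesRegularity.Theorems.CoriolisHeadCounterRotatingLiouvilleCalculus
import Literature.Analysis.FluidPDE.PineauVicolRSSChaeWolf
import Literature.Analysis.FluidPDE.ChaeWolfRemovingDSSProofs
import HarnessLib

/-!
# CoriolisHeadNoCoRotatingCoreKFoldExtremeRotation — crux `NoCoRotatingCore` (stmt-NavierStokesRegularity-22676):
# the planner's RUNG K(k) `KFoldExtremeRotationPV` is a THEOREM (seat ns-ffc-k1 g4; `--supports 22676 --as helper`)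

THE RUNG (ideator ns-idea-10 g5, crux idea «alpha-m-shift», typed OPEN in the crux work file
`Cruxes/NoCoRotatingCore/AlphaMShiftRungs.lean` as `KFoldExtremeRotationPV`, restated in
`…/AlphaMShiftWirtinger.lean § Skeleton`): for every Type-I constant `K > 0` there is a threshold `A = A(K) > 0`
such that every smooth solution `(U, P)` of the Pineau–Vicol-frame rotated Leray profile system

  `α(JU − DU[Jy]) + ½U + ½DU[y] − ΔU + (U·∇)U + ∇P = 0`, `∇·U = 0` (arXiv:2607.09619, (1.8)),

with the Type-I decay `‖U(y)‖ ≤ K/(1 + ‖y‖)` (1.9) which is `k`-FOLD SYMMETRIC about the rotation axis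
(`U(R_{2π/k} y) = R_{2π/k} U(y)`, `k ≥ 1`) and rotates fast RELATIVE TO ITS SYMMETRY ORDER, `k·|α| ≥ A`,
vanishes identically.  `k = 1` is Pineau–Vicol's Theorem 1.4 (ii) (the large-`|α|` half); the planner's card
derives the `1/k` gain from the `k`-fold Wirtinger constant inside PV §6 and leaves three published inputs open
([d] PV Lemma 2.1, [a-p] PV (6.13)–(6.15), [b] PV §6.5).

THIS FILE PROVES THE RUNG WITH NONE OF THEM (`kFoldExtremeRotation_liouville`, statement = the rung with its two
`def`s `IsPVProfile`, `IsKFoldSymmetric` unfolded verbatim), by the route Pineau–Vicol themselves point out for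
`k = 1` (p. 6: "[12] gives an alternative proof of the large `|α|` case in Theorem 1.4") — Remark 1.5 + Chae–Wolf 2017,
Thm 1.3 (`chaeWolf2017_removing_dss_holds`, PROVED in the tree) — with one new observation:

  **a `k`-fold symmetric `α`-RSS ansatz field is `c`-DSS with the SMALLER factor `c = e^{π/(k|α|)}`**
  (`pvAnsatz_nsRescale_of_equivariant`, `isDiscretelySelfSimilar_pvAnsatz_of_kFold`): under the parabolic
  rescaling by `c` the ansatz (1.7) picks up the twist `R(2α log c) = R(±2π/k)`, which the symmetry of the
  profile absorbs.  Chae–Wolf's window `1 < c < c₁(K)` is then exactly `k|α| > π / log c₁(K)`, so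
  `A(K) := π / log c₁(K) + 1` serves, the SAME `c₁(K)` for every `k` — the conjectured `A(1)/k` law of the
  idea card holds in the form `|α| ≥ A/k`.

Dictionary used: a smooth profile solution gives a classical Navier–Stokes solution `u = pvAnsatz α U` on
`(−∞, 0) × ℝ³` (`classicalOfProfile_isBackwardLeraySolutionOn` + `isClassicalNSSolutionOn_Iio_ofLerayOrbit_iff`,
after upgrading the `C²` pressure to `C^∞` from the system, `contDiff_pressure_of_rotated`), with the Type-I
bound (1.10) at the same constant (`norm_pvAnsatz_le_of_profile`), and `u(−1) = U` (`pvAnsatz_neg_one`).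

HONEST FRAMING.  A FENCE, not a closure: a putative profile in Pineau–Vicol's open window has symmetry order
`k < A(K)/|α|`.  The rung is WEAKER than the crux; `NoCoRotatingCore` (⟺ PV Conjecture 1.1 as printed,
`noCoRotatingCore_iff_pineauVicolConjecture`), Conjecture 1.1 itself and Navier–Stokes regularity are NOT proved.
Companion in tree (different mechanism, ineffective threshold, ANY `α`): `LargeOrderLiouville.largeOrderRssLiouville`.

References: B. Pineau, V. Vicol, arXiv:2607.09619 (2026), (1.7)–(1.10), Remark 1.5, Theorem 1.4, p. 6
[PineauVicol2026]; D. Chae, J. Wolf, Comm. PDE 42 (2017) 1359–1374 = arXiv:1610.09464, Thm 1.3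
[ChaeWolf2017RemovingDSS]; crux work files `Cruxes/NoCoRotatingCore/AlphaMShiftRungs.lean`,
`AlphaMShiftLineCard.md` (ns-idea-10 g5).
-/

noncomputable section

-- the summit and its single sub-problem share the name (CONVENTIONS §1), as in every Theorems file
set_option linter.dupNamespace false

open Set Function Filter
open Literature.Analysis.FluidPDE Literature.Analysis.FluidPDE.PineauVicol2026
open scoped RealInnerProductSpace Laplacian ContDiff Topology

namespace Summit.NavierStokesRegularity.NavierStokesRegularity.Theorems.CoriolisHead

/-! ## §1 The twisted scaling law of the ansatz against an equivariance of the profile -/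

/-- **Remark 1.5 with a symmetric profile.**  If the profile `U` is equivariant under the rotation by the
twist angle `φ = 2α log c` (`U(R_φ y) = R_φ U(y)`), then for `t < 0` the RSS ansatz field `u` of (1.7) satisfies
`c u(c²t, cx) = u(t, x)`: `s(c²t) = s(t) − 2 log c`, `√(−c²t) = c√(−t)`, and the surplus rotation `R(−φ)…R(φ)`
is absorbed by the equivariance.  (`φ ∈ 2πℤ` — every `U` — is `pvAnsatz_rss_nsRescale`.)
[cite: PineauVicol2026, Remark 1.5 (arXiv:2607.09619 pp. 5–6)] -/
theorem pvAnsatz_nsRescale_of_equivariant {α c : ℝ} (hc : 0 < c)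
    {U : EuclideanSpace ℝ (Fin 3) → EuclideanSpace ℝ (Fin 3)}
    (hU : ∀ y : EuclideanSpace ℝ (Fin 3),
      U (rotZ (α * (2 * Real.log c)) y) = rotZ (α * (2 * Real.log c)) (U y))
    {t : ℝ} (ht : t < 0) (x : EuclideanSpace ℝ (Fin 3)) :
    c • pvAnsatz α (fun y _ => U y) (c ^ 2 * t) (c • x) = pvAnsatz α (fun y _ => U y) t x := by
  have hnt : 0 < -t := by linarith
  have hs : 0 < Real.sqrt (-t) := Real.sqrt_pos.2 hnt
  have hsqrt : Real.sqrt (-(c ^ 2 * t)) = c * Real.sqrt (-t) := by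
    rw [show -(c ^ 2 * t) = c ^ 2 * (-t) by ring, Real.sqrt_mul (sq_nonneg c), Real.sqrt_sq hc.le]
  have hlog : Real.log (-(c ^ 2 * t)) = 2 * Real.log c + Real.log (-t) := by
    rw [show -(c ^ 2 * t) = c ^ 2 * (-t) by ring, Real.log_mul (by positivity) hnt.ne', Real.log_pow]
    push_cast
    ring
  set φ : ℝ := α * (2 * Real.log c) with hφ
  set θ : ℝ := α * -Real.log (-t) with hθ
  have h1 : α * -(2 * Real.log c + Real.log (-t)) = θ - φ := by rw [hθ, hφ]; ring
  have h2 : -(θ - φ) = φ + -θ := by ring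
  simp only [pvAnsatz]
  rw [hsqrt, hlog, h1, h2]
  have h3 : (c * Real.sqrt (-t))⁻¹ • (c • x) = (Real.sqrt (-t))⁻¹ • x := by
    rw [smul_smul]
    congr 1
    field_simp
  rw [h3, rotZ_add, hU, ← rotZ_add, sub_add_cancel, smul_smul]
  congr 1
  field_simp

/-- The ansatz field with a profile equivariant under the twist angle `2α log c`, `c > 0`, is `c`-discretely
self-similar (`c u(c²t, cx) = u(t, x)` for all `t`, `x`; for `t ≥ 0` both sides are the junk value `0`).
[cite: PineauVicol2026, Remark 1.5 (arXiv:2607.09619 pp. 5–6)] -/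
theorem isDiscretelySelfSimilar_pvAnsatz_of_equivariant {α c : ℝ} (hc : 0 < c)
    {U : EuclideanSpace ℝ (Fin 3) → EuclideanSpace ℝ (Fin 3)}
    (hU : ∀ y : EuclideanSpace ℝ (Fin 3),
      U (rotZ (α * (2 * Real.log c)) y) = rotZ (α * (2 * Real.log c)) (U y)) :
    IsDiscretelySelfSimilar c (pvAnsatz α (fun y _ => U y)) := by
  show nsRescale c (pvAnsatz α (fun y _ => U y)) = pvAnsatz α (fun y _ => U y)
  funext t x
  rw [nsRescale_apply]
  by_cases ht : t < 0
  · exact pvAnsatz_nsRescale_of_equivariant hc hU ht x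
  · have ht' : 0 ≤ t := not_lt.1 ht
    rw [pvAnsatz_of_nonneg _ _ (mul_nonneg (sq_nonneg c) ht'), pvAnsatz_of_nonneg _ _ ht', smul_zero]

/-- A `k`-fold symmetric field is also equivariant under the INVERSE generator `R_{−2π/k}`. [folklore] -/
theorem equivariant_neg_of_kFold {k : ℕ} {U : EuclideanSpace ℝ (Fin 3) → EuclideanSpace ℝ (Fin 3)}
    (hk : ∀ y : EuclideanSpace ℝ (Fin 3), U (rotZ (2 * Real.pi / k) y) = rotZ (2 * Real.pi / k) (U y))
    (y : EuclideanSpace ℝ (Fin 3)) :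
    U (rotZ (-(2 * Real.pi / k)) y) = rotZ (-(2 * Real.pi / k)) (U y) := by
  have h := hk (rotZ (-(2 * Real.pi / k)) y)
  rw [← rotZ_add, add_neg_cancel, rotZ_zero] at h
  rw [h, ← rotZ_add, neg_add_cancel, rotZ_zero]

/-- **The DSS factor of a `k`-fold symmetric RSS field is `e^{π/(k|α|)}`.**  If `U` is `k`-fold symmetric
about the axis (`k ≥ 1`) and `α ≠ 0`, the ansatz field `pvAnsatz α U` is `c`-DSS with `c = e^{π/(k|α|)}`:
the twist angle is `2α log c = sgn(α)·2π/k`. [cite: PineauVicol2026, Remark 1.5 (arXiv:2607.09619 pp. 5–6)] -/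
theorem isDiscretelySelfSimilar_pvAnsatz_of_kFold {k : ℕ} {α : ℝ} (hα : α ≠ 0)
    {U : EuclideanSpace ℝ (Fin 3) → EuclideanSpace ℝ (Fin 3)}
    (hk : ∀ y : EuclideanSpace ℝ (Fin 3), U (rotZ (2 * Real.pi / k) y) = rotZ (2 * Real.pi / k) (U y)) :
    IsDiscretelySelfSimilar (Real.exp (Real.pi / (k * |α|))) (pvAnsatz α (fun y _ => U y)) := by
  refine isDiscretelySelfSimilar_pvAnsatz_of_equivariant (Real.exp_pos _) fun y => ?_
  rw [Real.log_exp]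
  rcases lt_or_gt_of_ne hα with hneg | hpos
  · have e : α * (2 * (Real.pi / (k * |α|))) = -(2 * Real.pi / k) := by
      rw [abs_of_neg hneg]; field_simp
    rw [e]
    exact equivariant_neg_of_kFold hk y
  · have e : α * (2 * (Real.pi / (k * |α|))) = 2 * Real.pi / k := by
      rw [abs_of_pos hpos]; field_simp
    rw [e]
    exact hk y

/-! ## §2 From the profile system to a classical Type-I solution on the past -/

/-- **Profile ⇒ classical solution on `(−∞, 0)`.**  A smooth divergence-free `U` and a `C²` pressure `P`
solving the Pineau–Vicol-frame profile system give, through the ansatz `u = pvAnsatz α U`, a classical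
Navier–Stokes solution (`ν = 1`, `f = 0`) on the time set `(−∞, 0)` for some pressure; `P ∈ C²` is first
upgraded to `C^∞` from the system. [cite: PineauVicol2026, (1.7)–(1.8) (arXiv:2607.09619 p. 3)] -/
theorem exists_isClassicalNSSolutionOn_pvAnsatz_of_profile {α : ℝ}
    {U : EuclideanSpace ℝ (Fin 3) → EuclideanSpace ℝ (Fin 3)} {P : EuclideanSpace ℝ (Fin 3) → ℝ}
    (hU : ContDiff ℝ (⊤ : ℕ∞) U) (hP : ContDiff ℝ 2 P) (hdiv : VectorCalculus.IsDivFree U)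
    (heq : ∀ y, α • (rotGen (U y) - fderiv ℝ U y (rotGen y)) + (1 / 2 : ℝ) • U y
      + (1 / 2 : ℝ) • fderiv ℝ U y y - Laplacian.laplacian U y
      + Literature.Analysis.FluidPDE.convect U U y + gradient P y = 0) :
    ∃ p : ℝ → EuclideanSpace ℝ (Fin 3) → ℝ,
      IsClassicalNSSolutionOn (Iio 0) 1 0 (pvAnsatz α (fun y _ => U y)) p := by
  -- the system in the general frame `(ν, a, B) = (1, ½, αJ)`, for the pressure upgrade
  have heq' : ∀ y, -((1 : ℝ) • Laplacian.laplacian U y) + (1 / 2 : ℝ) • U y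
      + (1 / 2 : ℝ) • fderiv ℝ U y y + ((α • rotGenL) (U y) - fderiv ℝ U y ((α • rotGenL) y))
      + Literature.Analysis.FluidPDE.convect U U y + gradient P y = 0 := by
    intro y
    have key := heq y
    simp only [_root_.smul_apply, rotGenL_apply, ContinuousLinearMap.map_smul, one_smul]
    rw [← key, smul_sub]
    abel
  have hP' : ContDiff ℝ ∞ P := contDiff_pressure_of_rotated hU (hP.of_le (by norm_num)) heq'
  have hL := classicalOfProfile_isBackwardLeraySolutionOn (α := α) hU hP' hdiv (fun y => heq y)
  have hNS := isClassicalNSSolutionOn_Iio_ofLerayOrbit_iff.2 hL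
  refine ⟨ofLerayOrbitPressure fun (s : ℝ) (y : EuclideanSpace ℝ (Fin 3)) => P (rotZ (-(α * s)) y), ?_⟩
  have e : pvAnsatz α (fun y _ => U y) =
      ofLerayOrbit (fun (s : ℝ) (y : EuclideanSpace ℝ (Fin 3)) =>
        rotZ (α * s) (U (rotZ (-(α * s)) y))) := by
    funext t x
    rfl
  rw [e]
  exact hNS

/-- The profile decay `‖U(y)‖ ≤ K/(1 + ‖y‖)` gives the Type-I bound `‖u(t,x)‖ ≤ K/(‖x‖ + √(−t))` of the
ansatz field on the whole past (`HasTypeIDecay`). [cite: PineauVicol2026, Remark 1.2 (arXiv:2607.09619 pp. 3–4)] -/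
theorem hasTypeIDecay_pvAnsatz_of_profile {α K : ℝ} {U : EuclideanSpace ℝ (Fin 3) → EuclideanSpace ℝ (Fin 3)}
    (hdec : ∀ y, ‖U y‖ ≤ K / (1 + ‖y‖)) :
    HasTypeIDecay K (pvAnsatz α (fun y _ => U y)) := by
  have hdec' : ∀ y : EuclideanSpace ℝ (Fin 3), ‖U y‖ ≤ K / (‖y‖ + 1) := fun y => by
    rw [add_comm]; exact hdec y
  exact fun t ht x => norm_pvAnsatz_le_of_profile hdec' ht x

/-! ## §3 The rung -/

/-- **RUNG K(k) of crux 22676 (`KFoldExtremeRotationPV` of `Cruxes/NoCoRotatingCore/AlphaMShiftRungs.lean`,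
verbatim with `IsPVProfile` / `IsKFoldSymmetric` unfolded) — PROVED.**  For every `K > 0` there is `A > 0`
(namely `π / log c₁(K) + 1`, `c₁(K) > 1` Chae–Wolf's removal threshold for the Type-I constant `K`) such that:
every smooth solution `(U, P)` (`U ∈ C^∞`, `P ∈ C²`, `∇·U = 0`) of the Pineau–Vicol-frame rotated profile system
at rate `α` with `‖U(y)‖ ≤ K/(1 + ‖y‖)`, `k`-fold symmetric about the axis (`k ≥ 1`), and `A ≤ k|α|`, is
identically zero.  Proof: `α ≠ 0`; the ansatz field is a classical Type-I(`K`) solution on `(−∞,0)` which is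
`c`-DSS with `c = e^{π/(k|α|)} ∈ (1, c₁(K))`, hence zero by Chae–Wolf; at `t = −1` it is `U`.
[cite: ChaeWolf2017RemovingDSS, Theorem 1.3 (arXiv:1610.09464 p. 3)] -/
theorem kFoldExtremeRotation_liouville :
    ∀ K : ℝ, 0 < K → ∃ A : ℝ, 0 < A ∧
      ∀ (k : ℕ) (α : ℝ) (U : EuclideanSpace ℝ (Fin 3) → EuclideanSpace ℝ (Fin 3))
        (P : EuclideanSpace ℝ (Fin 3) → ℝ), 1 ≤ k →
        (ContDiff ℝ (⊤ : ℕ∞) U ∧ ContDiff ℝ 2 P ∧ Literature.Analysis.FluidPDE.VectorCalculus.IsDivFree U ∧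
          ∀ y, α • (rotGen (U y) - fderiv ℝ U y (rotGen y)) + (1 / 2 : ℝ) • U y
            + (1 / 2 : ℝ) • fderiv ℝ U y y - Laplacian.laplacian U y
            + Literature.Analysis.FluidPDE.convect U U y + gradient P y = 0) →
        (∀ y, ‖U y‖ ≤ K / (1 + ‖y‖)) →
        (∀ y, U (rotZ (2 * Real.pi / k) y) = rotZ (2 * Real.pi / k) (U y)) →
        A ≤ k * |α| → ∀ y, U y = 0 := by
  intro K hK
  obtain ⟨c₁, hc₁, H⟩ := chaeWolf2017_removing_dss_holds K hK
  have hlog₁ : 0 < Real.log c₁ := Real.log_pos hc₁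
  refine ⟨Real.pi / Real.log c₁ + 1, by positivity, ?_⟩
  intro k α U P hk hprof hdec hsym hA y
  obtain ⟨hU, hP, hdiv, heq⟩ := hprof
  have hkpos : (0 : ℝ) < k := by exact_mod_cast hk
  have hkα : Real.pi / Real.log c₁ < k * |α| := by linarith
  have hα0 : 0 < |α| := by
    by_contra hle
    have h0 : |α| = 0 := le_antisymm (not_lt.1 hle) (abs_nonneg α)
    rw [h0, mul_zero] at hkα
    exact (lt_irrefl (0 : ℝ)) ((div_pos Real.pi_pos hlog₁).trans hkα)
  have hαne : α ≠ 0 := abs_pos.1 hα0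
  have hkα0 : 0 < (k : ℝ) * |α| := mul_pos hkpos hα0
  -- the DSS factor `c = e^{π/(k|α|)} ∈ (1, c₁)`
  set c : ℝ := Real.exp (Real.pi / (k * |α|)) with hc_def
  have hc1 : 1 < c := Real.one_lt_exp_iff.2 (div_pos Real.pi_pos hkα0)
  have hcc₁ : c < c₁ := by
    rw [hc_def, ← Real.exp_log (zero_lt_one.trans hc₁), Real.exp_lt_exp, div_lt_iff₀ hkα0]
    have h := (div_lt_iff₀ hlog₁).1 hkα
    linarith [mul_comm (Real.log c₁) ((k : ℝ) * |α|)]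
  have hdss : IsDiscretelySelfSimilar c (pvAnsatz α (fun y _ => U y)) :=
    isDiscretelySelfSimilar_pvAnsatz_of_kFold hαne hsym
  obtain ⟨p, hp⟩ := exists_isClassicalNSSolutionOn_pvAnsatz_of_profile hU hP hdiv heq
  have hI : HasTypeIDecay K (pvAnsatz α (fun y _ => U y)) := hasTypeIDecay_pvAnsatz_of_profile hdec
  have h := H c hc1 hcc₁ _ p hp hdss hI (-1) (by norm_num) y
  rwa [pvAnsatz_neg_one] at h

/-- **The rung in Pineau–Vicol's printed (physical) rendering**, the shape of `pineauVicol2026_rss_liouville`: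
for every `C₀ > 0` there is `A > 0` such that a classical Navier–Stokes solution on `[−1, 0) × ℝ³` with the
Type-I bound `‖u(t,x)‖ ≤ C₀/(‖x‖ + √(−t))` which is the RSS ansatz (1.7) of a `k`-fold symmetric profile `U`
(`k ≥ 1`, no regularity of `U` assumed beyond the ansatz) at speed `α` with `A ≤ k|α|` has `U ≡ 0`.
(`k = 1`: the large-`|α|` half of Theorem 1.4, `pineauVicol2026_rss_liouville_large_of_chaeWolf`.)
[cite: PineauVicol2026, Theorem 1.4 and p. 6 (arXiv:2607.09619 pp. 4, 6)] -/
theorem kFold_rss_liouville_physical {C₀ : ℝ} (hC₀ : 0 < C₀) : ∃ A : ℝ, 0 < A ∧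
    ∀ (k : ℕ) (α : ℝ) (u : ℝ → EuclideanSpace ℝ (Fin 3) → EuclideanSpace ℝ (Fin 3))
      (p : ℝ → EuclideanSpace ℝ (Fin 3) → ℝ) (U : EuclideanSpace ℝ (Fin 3) → EuclideanSpace ℝ (Fin 3)), 1 ≤ k →
      IsClassicalNSSolutionOn (Ico (-1) 0) 1 0 u p →
      (∀ t ∈ Ico (-1 : ℝ) 0, ∀ x : EuclideanSpace ℝ (Fin 3),
        ‖u t x‖ ≤ C₀ / (‖x‖ + Real.sqrt (-t))) →
      (∀ y, U (rotZ (2 * Real.pi / k) y) = rotZ (2 * Real.pi / k) (U y)) →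
      (∀ t ∈ Ico (-1 : ℝ) 0, ∀ x : EuclideanSpace ℝ (Fin 3), u t x = pvAnsatz α (fun y _ => U y) t x) →
      A ≤ k * |α| → U = 0 := by
  obtain ⟨c₁, hc₁, H⟩ := chaeWolf2017_removing_dss_holds C₀ hC₀
  have hlog₁ : 0 < Real.log c₁ := Real.log_pos hc₁
  refine ⟨Real.pi / Real.log c₁ + 1, by positivity, ?_⟩
  intro k α u p U hk hsol hIu hsym hans hA
  have hkpos : (0 : ℝ) < k := by exact_mod_cast hk
  have hkα : Real.pi / Real.log c₁ < k * |α| := by linarith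
  have hα0 : 0 < |α| := by
    by_contra hle
    have h0 : |α| = 0 := le_antisymm (not_lt.1 hle) (abs_nonneg α)
    rw [h0, mul_zero] at hkα
    exact (lt_irrefl (0 : ℝ)) ((div_pos Real.pi_pos hlog₁).trans hkα)
  have hαne : α ≠ 0 := abs_pos.1 hα0
  have hkα0 : 0 < (k : ℝ) * |α| := mul_pos hkpos hα0
  set c : ℝ := Real.exp (Real.pi / (k * |α|)) with hc_def
  have hc1 : 1 < c := Real.one_lt_exp_iff.2 (div_pos Real.pi_pos hkα0)
  have hcc₁ : c < c₁ := by
    rw [hc_def, ← Real.exp_log (zero_lt_one.trans hc₁), Real.exp_lt_exp, div_lt_iff₀ hkα0]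
    have h := (div_lt_iff₀ hlog₁).1 hkα
    linarith [mul_comm (Real.log c₁) ((k : ℝ) * |α|)]
  have hdss : IsDiscretelySelfSimilar c (pvAnsatz α (fun y _ => U y)) :=
    isDiscretelySelfSimilar_pvAnsatz_of_kFold hαne hsym
  obtain ⟨P, hP⟩ := exists_isClassicalNSSolutionOn_Iio_of_rss hsol hc1 hdss hans
  have hIv : HasTypeIDecay C₀ (pvAnsatz α (fun y _ => U y)) :=
    fun t ht x => norm_pvAnsatz_le_of_profile (profile_bound_of_typeI hIu hans) ht x
  have hzero := H c hc1 hcc₁ _ P hP hdss hIv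
  funext y
  have h := hzero (-1) (by norm_num) y
  rwa [pvAnsatz_neg_one] at h

end Summit.NavierStokesRegularity.NavierStokesRegularity.Theorems.CoriolisHead

end
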